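import Summits.QuantumFields.BalabanUV.InfraRed.StrongCouplingFrozenPlaqKR
import Summits.QuantumFields.BalabanUV.InfraRed.StrongCouplingSlabAxialGauge

/-!
# Strong coupling, temporal axial gauge on the open-time slab — the frozen Dobrushin rows `≤ 14 (|β|/N) K` (part 4 of 5)

**observatory of the non-perturbative crossover; no mass-gap claim.**  Cell `pub-balaban`, build IR-3 v2
(two-front crossover ledger), IR-SC lineage, generation 13.  Part 4 of the SC-c door by complete temporal axial gauge
on the open-time slab (parts 1–3 `StrongCouplingFrozenPlaqSpec`, `StrongCouplingFrozenPlaqKR`,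
`StrongCouplingSlabAxialGauge`; part 5 `StrongCouplingSlabAxialClustering`).

THE COUNT (this part).  In the tree's Kantorovich–Rubinstein form of Dobrushin's condition on the slab
(`StrongCouplingOpenWindow` §2–§5) the row of the Dobrushin matrix at a link `v` is bounded by
`K (|β|/N) ∑_{y ∈ nbr v} n(v, y)` with `n(v, y)` the weighted number of staple letters equal to `y` among the plaquettes
reading `v`; un-gauged this is `≤ 3 · wdeg v ≤ 18` (`sum_infl_le`, `wdeg_slab_le`).  With every temporal link FROZEN
(`frozenCoeff`, part 2) the rows at temporal links vanish and, at a spatial link `(t, e)`, the two temporal letters of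
each of the `≤ 2` temporal plaquettes through it drop out:
`4 · ½ · 3 + 4 · ½ · 3 + 2 · 1 · 1 = 14` (§2, `sum_nbr_frozenCoeff_slab_le`) — Dobrushin's constant `18 ↦ 14`.
§1 is the generic frozen row count for any `PlaqSystem`.

Every statement is kernel-checked; nothing here moves any number of the ledger; no statement of the manuscripts under
audit is used.  References (method only): [cite: Follmer1988, Thm. (2.13)] [cite: Georgii2011, Prop. 8.8]
[cite: LuscherSchaefer2011, §2.4] [cite: Creutz2022, Ch. 9, eq. (9.19), p. 44].
-/

noncomputable section

open Finset
open Literature.MathematicalPhysics.QuantumFieldTheory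
open Literature.MathematicalPhysics.QuantumFieldTheory.Balaban1983to89
open Literature.MathematicalPhysics.QuantumFieldTheory.Balaban1983to89.StrongCouplingTorusWindow
open Literature.MathematicalPhysics.QuantumFieldTheory.Balaban1983to89.StrongCouplingOpenWindow
open Literature.MathematicalPhysics.QuantumFieldTheory.Balaban1983to89.StrongCouplingOpenWindow.PlaqSystem (stapleIdx)
open Summit.QuantumFields.BalabanUV.InfraRed.StrongCouplingFrozenPlaqSpec
open Summit.QuantumFields.BalabanUV.InfraRed.StrongCouplingFrozenPlaqKR
open Summit.QuantumFields.BalabanUV.InfraRed.StrongCouplingSlabAxialGauge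

namespace Summit.QuantumFields.BalabanUV.InfraRed.StrongCouplingSlabAxialRows

/-! ### §1 Frozen row sums of the influence count of a plaquette system -/

section Generic

variable {V P : Type*} [Fintype P] [DecidableEq V] (S : PlaqSystem V P)

/-- **Frozen row sums of the influence count**: if for every pair `(q, k)` reading the link `v` the weighted number of
NON-frozen staple letters is at most `w(q, k)`, then `∑_{y ∈ nbr v, y ∉ F} n(v, y) ≤ ∑_{(q,k) reading v} w(q, k)`.
[folklore] -/
theorem sum_nbr_ite_infl_le (F : Finset V) (v : V) {w : P × Fin 4 → ℝ}
    (hw : ∀ qk ∈ S.thru v,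
      S.coef qk.1 * (∑ j : Fin 3, if S.lk qk.1 (stapleIdx qk.2 j) ∈ F then (0 : ℝ) else 1) ≤ w qk) :
    ∑ y ∈ S.nbr v, (if y ∈ F then (0 : ℝ) else S.infl v y) ≤ ∑ qk ∈ S.thru v, w qk := by
  have hrw : ∀ y, (if y ∈ F then (0 : ℝ) else S.infl v y) = ∑ qk ∈ S.thru v, S.coef qk.1 *
      ∑ j : Fin 3, (if y ∈ F then (0 : ℝ) else 1) * (if S.lk qk.1 (stapleIdx qk.2 j) = y then 1 else 0) := by
    intro y
    by_cases hy : y ∈ F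
    · simp [hy]
    · simp only [hy, if_false, one_mul]
      rfl
  simp_rw [hrw]
  rw [Finset.sum_comm]
  refine Finset.sum_le_sum fun qk hqk => ?_
  rw [← Finset.mul_sum]
  refine (mul_le_mul_of_nonneg_left ?_ (S.coef_nonneg _)).trans (hw qk hqk)
  rw [Finset.sum_comm]
  refine Finset.sum_le_sum fun j _ => ?_
  rw [Finset.sum_mul_boole]
  split_ifs <;> norm_num

end Generic

/-! ### §2 The open-time slab in the temporal axial gauge: rows `≤ 14 (|β|/N) K` -/

section Slab

variable {L T : ℕ} [NeZero L] (hL : 1 < L)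

/-- Weighted number of non-frozen staple letters per slab plaquette in the temporal axial gauge: `½ · 3` for the two
spatial copies (the trivial count), `1 · 1` for a temporal plaquette read at a spatial letter (its two temporal
letters are frozen). [folklore] -/
def axialW : SlabPlaq L T → ℝ
  | Sum.inl _ => 3 / 2
  | Sum.inr (Sum.inl _) => 3 / 2
  | Sum.inr (Sum.inr _) => 1

/-- At most three staple letters are non-frozen (the trivial count). [folklore] -/
theorem sum_ite_mem_temporalLinks_le_three (q : SlabPlaq L T) (k : Fin 4) :
    (∑ j : Fin 3, if (slab hL).lk q (stapleIdx k j) ∈ temporalLinks L T then (0 : ℝ) else 1) ≤ 3 :=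
  (Finset.sum_le_sum fun j _ => show _ ≤ (1 : ℝ) by split_ifs <;> norm_num).trans (by simp)

/-- **The letter count in the axial gauge**: a pair `(q, k)` reading the spatial link `(t, e)` has weighted non-frozen
staple count `≤ axialW q` — for a temporal plaquette the link is read at position `1` or `3` and the staple consists of
the two (frozen) temporal letters and one spatial letter. [folklore] -/
theorem coef_mul_letters_le (t : Fin (T + 1)) (e : Edge 3 L) :
    ∀ qk ∈ (slab hL).thru (Sum.inl (t, e)),
      (slab hL).coef qk.1 *
          (∑ j : Fin 3, if (slab hL).lk qk.1 (stapleIdx qk.2 j) ∈ temporalLinks L T then (0 : ℝ) else 1) ≤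
        axialW qk.1 := by
  rintro ⟨q, k⟩ hqk
  rcases q with ip | ip | ie
  · have h3 := sum_ite_mem_temporalLinks_le_three hL (T := T) (Sum.inl ip) k
    simp only [slab_coef, slabCoef, axialW]
    linarith
  · have h3 := sum_ite_mem_temporalLinks_le_three hL (T := T) (Sum.inr (Sum.inl ip)) k
    simp only [slab_coef, slabCoef, axialW]
    linarith
  · have hk : slabLk (Sum.inr (Sum.inr ie)) k = Sum.inl (t, e) := by
      simpa using ((slab hL).mem_thru).1 hqk
    fin_cases k <;> simp [slabLk, stapleIdx, axialW, slabCoef, Fin.sum_univ_three] at hk ⊢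

/-- **Frozen spatial rows of the slab**: `∑_{y ∈ nbr (t,e), y spatial} n((t,e), y) ≤ 4·(3/2) + 4·(3/2) + 2·1 = 14`.
[cite: LuscherSchaefer2011, §2.4] -/
theorem sum_nbr_ite_infl_slab_le (t : Fin (T + 1)) (e : Edge 3 L) :
    ∑ y ∈ (slab hL).nbr (Sum.inl (t, e)),
      (if y ∈ temporalLinks L T then (0 : ℝ) else (slab hL).infl (Sum.inl (t, e)) y) ≤ 14 := by
  have hP : (plaqsThrough e).card ≤ 4 := (card_plaqsThrough_le e).trans (by norm_num)
  have hA : ∀ {a : ℝ}, 0 ≤ a → ∑ ip : Fin T × Plaquette 3 L,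
      (if (Sum.inl (t, e) : SlabLink L T) ∈ (slab hL).links (Sum.inl ip) then a else 0) ≤ (4 : ℕ) * a :=
    fun ha => sum_ite_le_of_card_le _ _ ha <|
      calc (Finset.univ.filter fun ip : Fin T × Plaquette 3 L =>
              (Sum.inl (t, e) : SlabLink L T) ∈ (slab hL).links (Sum.inl ip)).card
          ≤ ((Finset.univ.filter fun i : Fin T => i.castSucc = t) ×ˢ plaqsThrough e).card := by
            refine Finset.card_le_card fun ip hip => ?_
            obtain ⟨h2, h3⟩ := inl_mem_links_inl hL (Finset.mem_filter.1 hip).2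
            exact Finset.mem_product.2 ⟨Finset.mem_filter.2 ⟨Finset.mem_univ _, h2⟩, mem_plaqsThrough.2 h3⟩
        _ ≤ 1 * 4 := by
            rw [Finset.card_product]
            exact Nat.mul_le_mul (card_filter_castSucc_le t) hP
        _ = 4 := by norm_num
  have hB : ∀ {a : ℝ}, 0 ≤ a → ∑ ip : Fin T × Plaquette 3 L,
      (if (Sum.inl (t, e) : SlabLink L T) ∈ (slab hL).links (Sum.inr (Sum.inl ip)) then a else 0) ≤ (4 : ℕ) * a :=
    fun ha => sum_ite_le_of_card_le _ _ ha <|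
      calc (Finset.univ.filter fun ip : Fin T × Plaquette 3 L =>
              (Sum.inl (t, e) : SlabLink L T) ∈ (slab hL).links (Sum.inr (Sum.inl ip))).card
          ≤ ((Finset.univ.filter fun i : Fin T => i.succ = t) ×ˢ plaqsThrough e).card := by
            refine Finset.card_le_card fun ip hip => ?_
            obtain ⟨h2, h3⟩ := inl_mem_links_inr_inl hL (Finset.mem_filter.1 hip).2
            exact Finset.mem_product.2 ⟨Finset.mem_filter.2 ⟨Finset.mem_univ _, h2⟩, mem_plaqsThrough.2 h3⟩
        _ ≤ 1 * 4 := by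
            rw [Finset.card_product]
            exact Nat.mul_le_mul (card_filter_succ_le t) hP
        _ = 4 := by norm_num
  have hC : ∀ {a : ℝ}, 0 ≤ a → ∑ ie : Fin T × Edge 3 L,
      (if (Sum.inl (t, e) : SlabLink L T) ∈ (slab hL).links (Sum.inr (Sum.inr ie)) then a else 0) ≤ (2 : ℕ) * a :=
    fun ha => sum_ite_le_of_card_le _ _ ha <|
      calc (Finset.univ.filter fun ie : Fin T × Edge 3 L =>
              (Sum.inl (t, e) : SlabLink L T) ∈ (slab hL).links (Sum.inr (Sum.inr ie))).card
          ≤ (((Finset.univ.filter fun i : Fin T => i.succ = t) ∪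
              (Finset.univ.filter fun i : Fin T => i.castSucc = t)) ×ˢ ({e} : Finset (Edge 3 L))).card := by
            refine Finset.card_le_card fun ie hie => ?_
            obtain ⟨he, ht⟩ := inl_mem_links_inr_inr hL (Finset.mem_filter.1 hie).2
            refine Finset.mem_product.2 ⟨Finset.mem_union.2 ?_, Finset.mem_singleton.2 he⟩
            rcases ht with ht | ht
            · exact Or.inl (Finset.mem_filter.2 ⟨Finset.mem_univ _, ht⟩)
            · exact Or.inr (Finset.mem_filter.2 ⟨Finset.mem_univ _, ht⟩)
        _ ≤ (1 + 1) * 1 := by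
            rw [Finset.card_product, Finset.card_singleton]
            exact Nat.mul_le_mul_right _ ((Finset.card_union_le _ _).trans
              (Nat.add_le_add (card_filter_succ_le t) (card_filter_castSucc_le t)))
        _ = 2 := by norm_num
  calc _ ≤ ∑ qk ∈ (slab hL).thru (Sum.inl (t, e)), axialW qk.1 :=
        sum_nbr_ite_infl_le (slab hL) (temporalLinks L T) (Sum.inl (t, e)) (coef_mul_letters_le hL t e)
    _ = ∑ q ∈ (slab hL).pthru (Sum.inl (t, e)), axialW q := (slab hL).sum_thru_eq_sum_pthru axialW _
    _ ≤ 14 := by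
        unfold PlaqSystem.pthru
        rw [Finset.sum_filter, Fintype.sum_sum_type, Fintype.sum_sum_type]
        simp only [axialW]
        have h1 := hA (a := 3 / 2) (by norm_num)
        have h2 := hB (a := 3 / 2) (by norm_num)
        have h3 := hC (a := 1) (by norm_num)
        push_cast at h1 h2 h3
        linarith

/-- **THE FROZEN DOBRUSHIN ROWS OF THE SLAB ARE `≤ 14 (|β|/N) K`** (temporal links frozen: their rows vanish; spatial
links: `sum_nbr_ite_infl_slab_le`).  Un-gauged the tree's bound is `18 (|β|/N) K`. [folklore] -/
theorem sum_nbr_frozenCoeff_slab_le (N : ℕ) {K : ℝ} (hK : 0 ≤ K) (β : ℝ) (v : SlabLink L T) :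
    ∑ y ∈ (slab hL).nbr v, frozenCoeff (slab hL) (N := N) (temporalLinks L T) K β v y ≤ 14 * (|β| / N) * K := by
  have h0 : 0 ≤ 14 * (|β| / N) * K := by positivity
  rcases v with ⟨t, e⟩ | ix
  · have hrw : ∀ y, frozenCoeff (slab hL) (N := N) (temporalLinks L T) K β (Sum.inl (t, e)) y =
        K * (|β| / N) * (if y ∈ temporalLinks L T then (0 : ℝ) else (slab hL).infl (Sum.inl (t, e)) y) := by
      intro y
      rw [frozenCoeff_apply]
      by_cases hy : y ∈ temporalLinks L T
      · simp [hy]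
      · simp [hy]
    simp_rw [hrw]
    rw [← Finset.mul_sum]
    calc K * (|β| / N) * _ ≤ K * (|β| / N) * 14 :=
          mul_le_mul_of_nonneg_left (sum_nbr_ite_infl_slab_le hL t e) (by positivity)
      _ = 14 * (|β| / N) * K := by ring
  · have hrw : ∀ y, frozenCoeff (slab hL) (N := N) (temporalLinks L T) K β (Sum.inr ix) y = 0 := fun y => by
      rw [frozenCoeff_apply, if_pos (Or.inl (inr_mem_temporalLinks ix))]
    simp_rw [hrw]
    rw [Finset.sum_const_zero]
    exact h0

end Slab

end Summit.QuantumFields.BalabanUV.InfraRed.StrongCouplingSlabAxialRows
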